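import Summits.ResolutionOfSingularities.ResolutionOfSingularities.Theorems.RadicialJungCleanModelsCleanSpreadsRegularType
import Summits.ResolutionOfSingularities.ResolutionOfSingularities.Theorems.RadicialJungCleanModelsCleanSpreadsToroidal
import Summits.ResolutionOfSingularities.ResolutionOfSingularities.Theorems.RadicialJungCleanModelsCleanSpreadsNodal
import Summits.ResolutionOfSingularities.ResolutionOfSingularities.Theorems.RadicialJungCleanModelsStubParameterSubset
import Summits.ResolutionOfSingularities.ResolutionOfSingularities.Theorems.RadicialJungCleanModelsReduction
import Literature.AlgebraicGeometry.Resolution.ResolutionOfSingularities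
import Literature.AlgebraicGeometry.Resolution.SpreadingGerms
import HarnessLib

/-!
# Stub `stub_cleanSpreads` for crux stmt-ResolutionOfSingularities-15917
(`RadicialJung.CleanModels`, line `Sketch` rev 7)

**Cleanness spreads from a closed point; nodal points are isolated.** On a regular integral
scheme `V` locally of finite type over a field `k` of characteristic `p`, if a rational function
`x ∈ K(V)` is loosely clean OR of nodal type at a closed point `v`, then `x` is loosely clean at
every other closed point of an open neighbourhood of `v`.

## Proof

Work on an affine neighbourhood `Spec A ∋ v` over which all the germs of the clean / nodal form
are sections (`SpreadingGerms.lean`); `A` is a finitely generated `k`-domain, the stalks are its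
localisations `A_𝔮`, `v` is a maximal ideal `𝔭`.

* **Derivations of finite type dual to a regular system of parameters**
  (`exists_derivations_dual_of_finiteType`, part 1 `…CleanSpreadsDualDerivations.lean`): for a
  regular system of parameters `a_1, …, a_d ∈ A` of `A_𝔭` there are derivations
  `E_1, …, E_d ∈ Der(A)` of `A` ITSELF and `e ∈ A ∖ 𝔭` with `E_j(a_l) = e δ_jl`. Present `A = S/I`, `S = k[X_1, …, X_n]`, `M ⊇ I` the maximal ideal over
  `𝔭`; `I S_M` is generated by part `g_1, …, g_c ∈ I` of a regular system of parameters
  `(g, a)` of `S_M` (Matsumura Thm. 14.2, tree `exists_span_eq_of_isRegularLocalRing_quotient`);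
  the weak Jacobian condition (WJ) at `M` (tree `isWeakJacobianAt_mvPolynomial`, Matsumura
  Thms. 30.3/30.5) gives `D_1, …, D_n ∈ Der(S)` with `det(D_i y_j) ∉ M` for `y = (g, a)`;
  the adjugate combinations `E = adj(Dy) · D ∈ Der(S)` satisfy `E_j(y_l) = det(Dy) δ_jl`, so the
  `E_j` dual to the `a`-block kill the `g_i`, hence preserve `I` and descend to `A`.
* **Unit derivative ⇒ regular type** (`stub_leibnizObstruction`, landed): if `E(s) ∉ 𝔮` for
  some `E ∈ Der(A)`, then at `A_𝔮` either `s` is a unit with `s - c^p ∉ 𝔪` for all `c`, or some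
  `s - c^p ∈ 𝔪 ∖ 𝔪²`.
* The four cases (parts 2–4, `…CleanSpreadsRegularType.lean`, `…CleanSpreadsToroidal.lean`,
  `…CleanSpreadsNodal.lean`). (iii) `s - c^p = a_0`: `E_0(s) = e`. (ii) `u` a unit, `ū ∉ κ(v)^p`: in
  `A[Y]` the ideal `𝔔 = (𝔭, Y^p - u)` is maximal with `A[Y]_𝔔` regular of dimension `d + 1`
  and regular system of parameters `(Y^p - u, a)`; the derivation dual to `Y^p - u`, restricted
  to `A` and followed by a coefficient functional, is an `E ∈ Der(A)` with `E(u) ∉ 𝔭`.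
  (i) toroidal `s = u ∏ a_i^{α_i}`: off the boundary `a_0 E_0(s) = (∏ a_i^{α_i})(a_0 E_0 u +
  α_0 e u)` is a unit; on the boundary the vanishing `a_i` keep independent differentials
  (`E_j a_i = e δ_ji`) and extend to a regular system of parameters of `A_𝔮`. (iv) nodal
  `s = u f^e`, `f ≡ c a_1 a_2 (mod 𝔪³)`: `E_j f ≡ c e a_{3-j}` and
  `G_j = f E_j u + e u E_j f ≡ e u c e a_{3-j} (mod 𝔪²)`, so `(E_1 f, E_2 f)` and `(G_1, G_2)`
  generate `𝔪_v` (Nakayama) and hence are not both in any other prime near `𝔭`; off `V(f)`,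
  `f E_j(s) = f^e G_j` is a unit, and on `V(f)`, `E_j f` a unit makes `f` a regular parameter,
  `s = u f^e` toroidal with `m = 1`.
-/

noncomputable section

set_option linter.dupNamespace false -- mandated namespace of this single-conjunct summit

open CategoryTheory AlgebraicGeometry TopologicalSpace IsLocalRing
open Literature.AlgebraicGeometry.Resolution Literature.AlgebraicGeometry.Motives

namespace Summit.ResolutionOfSingularities.ResolutionOfSingularities.Theorems.RadicialJung.CleanModels

universe u v w

/-! ## The scheme wrapper -/

section SchemeWrapper

/-- Sections over an affine open of a scheme locally of finite type over a field `k` of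
characteristic `p` form a finitely generated `k`-algebra of characteristic `p`. -/
theorem exists_algebra_finiteType_sections (p : ℕ) (k : Type) [Field k] [CharP k p]
    (V : Scheme.{0}) (f : V ⟶ Spec (.of k)) [LocallyOfFiniteType f]
    (U : V.Opens) (hU : IsAffineOpen U) [Nontrivial Γ(V, U)] :
    ∃ _ : Algebra k Γ(V, U), Algebra.FiniteType k Γ(V, U) ∧ CharP Γ(V, U) p := by
  let φ : k →+* Γ(V, U) := (f.appLE ⊤ U le_top).hom.comp (Scheme.ΓSpecIso (.of k)).inv.hom
  have hφ : φ.FiniteType := by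
    refine RingHom.FiniteType.comp ?_ (RingHom.FiniteType.of_surjective _
      (Scheme.ΓSpecIso (.of k)).symm.commRingCatIsoToRingEquiv.surjective)
    exact HasRingHomProperty.appLE @LocallyOfFiniteType f ‹_› ⟨⊤, isAffineOpen_top _⟩ ⟨U, hU⟩
      le_top
  exact ⟨φ.toAlgebra, hφ, (φ.charP_iff_charP p).mp inferInstance⟩

/-- **From the affine algebra to an open neighbourhood.** If `h ∈ Γ(V, U)` (`U` affine, `v ∈ U`)
does not vanish at `v` and the rational function `x` is loosely clean at every localisation of
`Γ(V, U)` at a prime `𝔮 ≠ 𝔭_v` not containing `h`, then `x` is loosely clean at every point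
`v' ≠ v` of the basic open `D(h) ∋ v` (the stalk `𝒪_{V,v'}` is the localisation of `Γ(V, U)` at
`𝔭_{v'}`, and `𝔭_{v'} = 𝔭_v` forces `v' = v`). -/
theorem exists_opens_of_spreads (p : ℕ) (V : Scheme.{0}) [IsIntegral V]
    (hVreg : Scheme.IsRegular V) (x : V.functionField) (v : V) (Ua : V.Opens)
    (hU : IsAffineOpen Ua) (hvU : v ∈ Ua) [Nonempty Ua] (h : Γ(V, Ua))
    (hh : h ∉ (hU.primeIdealOf ⟨v, hvU⟩).asIdeal)
    (H : ∀ (𝔮 : Ideal Γ(V, Ua)) [𝔮.IsPrime], h ∉ 𝔮 → 𝔮 ≠ (hU.primeIdealOf ⟨v, hvU⟩).asIdeal →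
      ∀ (O' : Type) [CommRing O'] [Algebra Γ(V, Ua) O'] [IsLocalization.AtPrime O' 𝔮]
        [IsRegularLocalRing O'] [Algebra O' V.functionField]
        [IsScalarTower Γ(V, Ua) O' V.functionField],
      ((∃ (d m : ℕ) (hmd : m ≤ d) (t : Fin d → O') (a : Fin m → ℕ) (u : O'), IsUnit u ∧
          Ideal.span (Set.range t) = maximalIdeal O' ∧
          ringKrullDim O' = (d : WithBot ℕ∞) ∧ 0 < m ∧ (∀ i, ¬ p ∣ a i) ∧
          x = algebraMap O' V.functionField (u * ∏ i : Fin m, t (Fin.castLE hmd i) ^ (a i))) ∨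
        (∃ u : O', IsUnit u ∧ x = algebraMap O' V.functionField u ∧
          ∀ c' : O', u - c' ^ p ∉ maximalIdeal O') ∨
        (∃ s c' : O', x = algebraMap O' V.functionField s ∧
          s - c' ^ p ∈ maximalIdeal O' ∧ s - c' ^ p ∉ maximalIdeal O' ^ 2))) :
    ∃ U : V.Opens, v ∈ U ∧ ∀ v' : V, v' ∈ U → IsClosed ({v'} : Set V) → v' ≠ v →
      ((∃ (d m : ℕ) (hmd : m ≤ d) (t : Fin d → V.presheaf.stalk v') (a : Fin m → ℕ)
          (u : V.presheaf.stalk v'), IsUnit u ∧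
          Ideal.span (Set.range t) = maximalIdeal (V.presheaf.stalk v') ∧
          ringKrullDim (V.presheaf.stalk v') = (d : WithBot ℕ∞) ∧ 0 < m ∧ (∀ i, ¬ p ∣ a i) ∧
          x = algebraMap (V.presheaf.stalk v') V.functionField
            (u * ∏ i : Fin m, t (Fin.castLE hmd i) ^ (a i))) ∨
        (∃ u : V.presheaf.stalk v', IsUnit u ∧
          x = algebraMap (V.presheaf.stalk v') V.functionField u ∧
          ∀ c' : V.presheaf.stalk v', u - c' ^ p ∉ maximalIdeal (V.presheaf.stalk v')) ∨
        (∃ s c' : V.presheaf.stalk v', x = algebraMap (V.presheaf.stalk v') V.functionField s ∧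
          s - c' ^ p ∈ maximalIdeal (V.presheaf.stalk v') ∧
          s - c' ^ p ∉ maximalIdeal (V.presheaf.stalk v') ^ 2)) := by
  refine ⟨V.basicOpen h, ?_, fun v' hv' _ hne => ?_⟩
  · letI := TopCat.Presheaf.algebra_section_stalk V.presheaf (⟨v, hvU⟩ : Ua)
    haveI := hU.isLocalization_stalk ⟨v, hvU⟩
    refine (V.mem_basicOpen h v hvU).mpr ?_
    exact (IsLocalization.AtPrime.isUnit_to_map_iff (V.presheaf.stalk v)
      (hU.primeIdealOf ⟨v, hvU⟩).asIdeal h).mpr hh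
  · have hv'U : v' ∈ Ua := V.basicOpen_le h hv'
    letI := TopCat.Presheaf.algebra_section_stalk V.presheaf (⟨v', hv'U⟩ : Ua)
    haveI := hU.isLocalization_stalk ⟨v', hv'U⟩
    haveI : IsRegularLocalRing (V.presheaf.stalk v') := hVreg v'
    haveI := functionField_isScalarTower V Ua ⟨v', hv'U⟩
    have hq : h ∉ (hU.primeIdealOf ⟨v', hv'U⟩).asIdeal :=
      (IsLocalization.AtPrime.isUnit_to_map_iff (V.presheaf.stalk v')
        (hU.primeIdealOf ⟨v', hv'U⟩).asIdeal h).mp ((V.mem_basicOpen h v' hv'U).mp hv')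
    have hne' : (hU.primeIdealOf ⟨v', hv'U⟩).asIdeal ≠ (hU.primeIdealOf ⟨v, hvU⟩).asIdeal := by
      intro heq
      apply hne
      have h1 := hU.fromSpec_primeIdealOf ⟨v', hv'U⟩
      rw [PrimeSpectrum.ext heq, hU.fromSpec_primeIdealOf ⟨v, hvU⟩] at h1
      exact h1.symm
    exact H _ hq hne' (V.presheaf.stalk v')

end SchemeWrapper

/-! ## The stub -/

/-- **Cleanness spreads from a closed point; nodal points are isolated** (stub `stub_cleanSpreads`
of the line `Sketch`, rev 7). On a regular integral scheme `V` locally of finite type over a field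
`k` of characteristic `p`, if a rational function `x ∈ K(V)` is loosely clean OR of nodal type at a
closed point `v`, then `x` is loosely clean at every other closed point of an open neighbourhood
of `v`. See the module docstring for the proof. -/
theorem stub_cleanSpreads (p : ℕ) (hp : p.Prime) (k : Type) [Field k] [CharP k p]
    (V : Scheme.{0}) [IsIntegral V] (f : V ⟶ Spec (.of k)) [LocallyOfFiniteType f]
    (hVreg : Scheme.IsRegular V) (x : V.functionField) (v : V) (hv : IsClosed ({v} : Set V))
    (hx : ((∃ (d m : ℕ) (hmd : m ≤ d) (t : Fin d → V.presheaf.stalk v) (a : Fin m → ℕ)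
            (u : V.presheaf.stalk v), IsUnit u ∧
            Ideal.span (Set.range t) = maximalIdeal (V.presheaf.stalk v) ∧
            ringKrullDim (V.presheaf.stalk v) = (d : WithBot ℕ∞) ∧ 0 < m ∧ (∀ i, ¬ p ∣ a i) ∧
            x =
              algebraMap (V.presheaf.stalk v) V.functionField
                (u * ∏ i : Fin m, t (Fin.castLE hmd i) ^ (a i))) ∨
          (∃ u : V.presheaf.stalk v, IsUnit u ∧
            x = algebraMap (V.presheaf.stalk v) V.functionField u ∧
            ∀ c' : V.presheaf.stalk v, u - c' ^ p ∉ maximalIdeal (V.presheaf.stalk v)) ∨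
          (∃ s c' : V.presheaf.stalk v, x = algebraMap (V.presheaf.stalk v) V.functionField s ∧
            s - c' ^ p ∈ maximalIdeal (V.presheaf.stalk v) ∧
            s - c' ^ p ∉ maximalIdeal (V.presheaf.stalk v) ^ 2)) ∨
      (∃ (u f₁ c t₁ t₂ : V.presheaf.stalk v) (e : ℕ), IsUnit u ∧ IsUnit c ∧ ¬ p ∣ e ∧
            Ideal.span {t₁, t₂} = maximalIdeal (V.presheaf.stalk v) ∧
            ringKrullDim (V.presheaf.stalk v) = (2 : WithBot ℕ∞) ∧
            x = algebraMap (V.presheaf.stalk v) V.functionField (u * f₁ ^ e) ∧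
            f₁ - c * t₁ * t₂ ∈ maximalIdeal (V.presheaf.stalk v) ^ 3)) :
    ∃ U : V.Opens, v ∈ U ∧ ∀ v' : V, v' ∈ U → IsClosed ({v'} : Set V) → v' ≠ v →
      ((∃ (d m : ℕ) (hmd : m ≤ d) (t : Fin d → V.presheaf.stalk v') (a : Fin m → ℕ)
          (u : V.presheaf.stalk v'), IsUnit u ∧
          Ideal.span (Set.range t) = maximalIdeal (V.presheaf.stalk v') ∧
          ringKrullDim (V.presheaf.stalk v') = (d : WithBot ℕ∞) ∧ 0 < m ∧ (∀ i, ¬ p ∣ a i) ∧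
          x =
            algebraMap (V.presheaf.stalk v') V.functionField
              (u * ∏ i : Fin m, t (Fin.castLE hmd i) ^ (a i))) ∨
        (∃ u : V.presheaf.stalk v', IsUnit u ∧
          x = algebraMap (V.presheaf.stalk v') V.functionField u ∧
          ∀ c' : V.presheaf.stalk v', u - c' ^ p ∉ maximalIdeal (V.presheaf.stalk v')) ∨
        (∃ s c' : V.presheaf.stalk v', x = algebraMap (V.presheaf.stalk v') V.functionField s ∧
          s - c' ^ p ∈ maximalIdeal (V.presheaf.stalk v') ∧
          s - c' ^ p ∉ maximalIdeal (V.presheaf.stalk v') ^ 2)) := by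
  haveI : Fact p.Prime := ⟨hp⟩
  haveI hOreg : IsRegularLocalRing (V.presheaf.stalk v) := hVreg v
  rcases hx with ((hT | hU | hP) | hN)
  · -- case (i): toroidal at `v`
    obtain ⟨d, m, hmd, t, α, u, hu, ht, hd, hm, hα, hxu⟩ := hT
    obtain ⟨⟨Ua, hUa⟩, hvU, -, sec, hsec⟩ :=
      exists_affineOpen_sections_of_germs V v (Fin.cons u t) ⊤ trivial
    haveI : Nonempty Ua := ⟨⟨v, hvU⟩⟩
    obtain ⟨algk, hft, hchar⟩ := exists_algebra_finiteType_sections p k V f Ua hUa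
    letI := algk
    haveI := hft
    haveI := hchar
    letI := TopCat.Presheaf.algebra_section_stalk V.presheaf (⟨v, hvU⟩ : Ua)
    haveI := hUa.isLocalization_stalk ⟨v, hvU⟩
    haveI := hUa.primeIdealOf_isMaximal_of_isClosed ⟨v, hvU⟩ hv
    haveI := functionField_isScalarTower V Ua ⟨v, hvU⟩
    have hgerm : ∀ z : Γ(V, Ua),
        algebraMap Γ(V, Ua) (V.presheaf.stalk v) z = V.presheaf.germ Ua v hvU z := fun z => rfl
    have huA : algebraMap Γ(V, Ua) (V.presheaf.stalk v) (sec 0) = u := by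
      rw [hgerm, hsec]; rfl
    have haA : ∀ i : Fin d, algebraMap Γ(V, Ua) (V.presheaf.stalk v) (sec i.succ) = t i := by
      intro i
      rw [hgerm, hsec, Fin.cons_succ]
    have ha' : Ideal.span (Set.range fun i : Fin d =>
        algebraMap Γ(V, Ua) (V.presheaf.stalk v) (sec i.succ)) =
        maximalIdeal (V.presheaf.stalk v) := by
      rw [← ht]
      congr 1
      ext z
      simp only [Set.mem_range, haA]
    have hu𝔭 : sec 0 ∉ (hUa.primeIdealOf ⟨v, hvU⟩).asIdeal :=
      (IsLocalization.AtPrime.isUnit_to_map_iff (V.presheaf.stalk v)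
        (hUa.primeIdealOf ⟨v, hvU⟩).asIdeal (sec 0)).mp (huA ▸ hu)
    have hx' : x = algebraMap Γ(V, Ua) V.functionField
        (sec 0 * ∏ i : Fin m, (fun i : Fin d => sec i.succ) (Fin.castLE hmd i) ^ α i) := by
      rw [hxu, IsScalarTower.algebraMap_apply Γ(V, Ua) (V.presheaf.stalk v) V.functionField]
      congr 1
      rw [map_mul, map_prod, huA]
      simp only [map_pow, haA]
    obtain ⟨h, hh, H⟩ := spreads_of_toroidal k p hp (𝔭 := (hUa.primeIdealOf ⟨v, hvU⟩).asIdeal)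
      (V.presheaf.stalk v) x hmd (fun i : Fin d => sec i.succ) α (sec 0) hu𝔭 ha' hd hm hα hx'
    exact exists_opens_of_spreads p V hVreg x v Ua hUa hvU h hh H
  · -- case (ii): `x = u` a unit with residue not a `p`-th power
    obtain ⟨u, hu, hxu, hup⟩ := hU
    obtain ⟨d, t, ht, hd⟩ := exists_fin_span_eq_maximalIdeal_ringKrullDim_eq (V.presheaf.stalk v)
    obtain ⟨⟨Ua, hUa⟩, hvU, -, sec, hsec⟩ :=
      exists_affineOpen_sections_of_germs V v (Fin.cons u t) ⊤ trivial
    haveI : Nonempty Ua := ⟨⟨v, hvU⟩⟩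
    obtain ⟨algk, hft, hchar⟩ := exists_algebra_finiteType_sections p k V f Ua hUa
    letI := algk
    haveI := hft
    haveI := hchar
    letI := TopCat.Presheaf.algebra_section_stalk V.presheaf (⟨v, hvU⟩ : Ua)
    haveI := hUa.isLocalization_stalk ⟨v, hvU⟩
    haveI := hUa.primeIdealOf_isMaximal_of_isClosed ⟨v, hvU⟩ hv
    haveI := functionField_isScalarTower V Ua ⟨v, hvU⟩
    have hgerm : ∀ z : Γ(V, Ua),
        algebraMap Γ(V, Ua) (V.presheaf.stalk v) z = V.presheaf.germ Ua v hvU z := fun z => rfl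
    have huA : algebraMap Γ(V, Ua) (V.presheaf.stalk v) (sec 0) = u := by
      rw [hgerm, hsec]; rfl
    have haA : ∀ i : Fin d, algebraMap Γ(V, Ua) (V.presheaf.stalk v) (sec i.succ) = t i := by
      intro i
      rw [hgerm, hsec, Fin.cons_succ]
    have ha' : Ideal.span (Set.range fun i : Fin d =>
        algebraMap Γ(V, Ua) (V.presheaf.stalk v) (sec i.succ)) =
        maximalIdeal (V.presheaf.stalk v) := by
      rw [← ht]
      congr 1
      ext z
      simp only [Set.mem_range, haA]
    have hx' : x = algebraMap Γ(V, Ua) V.functionField (sec 0) := by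
      rw [hxu, ← huA, ← IsScalarTower.algebraMap_apply]
    have hup' : ∀ c : V.presheaf.stalk v, algebraMap Γ(V, Ua) (V.presheaf.stalk v) (sec 0) - c ^ p ∉
        maximalIdeal (V.presheaf.stalk v) := by
      rw [huA]
      exact hup
    obtain ⟨h, hh, H⟩ := spreads_of_unit k p hp (𝔭 := (hUa.primeIdealOf ⟨v, hvU⟩).asIdeal)
      (V.presheaf.stalk v) x (fun i : Fin d => sec i.succ) (sec 0) ha' hd hx' hup'
    exact exists_opens_of_spreads p V hVreg x v Ua hUa hvU h hh H
  · -- case (iii): `x = s`, `s - c'^p ∈ 𝔪_v ∖ 𝔪_v²`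
    obtain ⟨s, c', hxs, h1, h2⟩ := hP
    obtain ⟨d, hd0, t, ht, hd, ht0⟩ := stub_extendParameter (s - c' ^ p) h1 h2
    obtain ⟨⟨Ua, hUa⟩, hvU, -, sec, hsec⟩ :=
      exists_affineOpen_sections_of_germs V v (Fin.cons s (Fin.cons c' t)) ⊤ trivial
    haveI : Nonempty Ua := ⟨⟨v, hvU⟩⟩
    obtain ⟨algk, hft, hchar⟩ := exists_algebra_finiteType_sections p k V f Ua hUa
    letI := algk
    haveI := hft
    haveI := hchar
    letI := TopCat.Presheaf.algebra_section_stalk V.presheaf (⟨v, hvU⟩ : Ua)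
    haveI := hUa.isLocalization_stalk ⟨v, hvU⟩
    haveI := hUa.primeIdealOf_isMaximal_of_isClosed ⟨v, hvU⟩ hv
    haveI := functionField_isScalarTower V Ua ⟨v, hvU⟩
    have hgerm : ∀ z : Γ(V, Ua),
        algebraMap Γ(V, Ua) (V.presheaf.stalk v) z = V.presheaf.germ Ua v hvU z := fun z => rfl
    have hsA : algebraMap Γ(V, Ua) (V.presheaf.stalk v) (sec 0) = s := by
      rw [hgerm, hsec]; rfl
    have hcA : algebraMap Γ(V, Ua) (V.presheaf.stalk v) (sec 1) = c' := by
      rw [hgerm, hsec]; rfl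
    have haA : ∀ i : Fin d, algebraMap Γ(V, Ua) (V.presheaf.stalk v) (sec i.succ.succ) = t i := by
      intro i
      rw [hgerm, hsec, Fin.cons_succ, Fin.cons_succ]
    have ha' : Ideal.span (Set.range fun i : Fin d =>
        algebraMap Γ(V, Ua) (V.presheaf.stalk v) (sec i.succ.succ)) =
        maximalIdeal (V.presheaf.stalk v) := by
      rw [← ht]
      congr 1
      ext z
      simp only [Set.mem_range, haA]
    have ha0' : (fun i : Fin d => sec i.succ.succ) ⟨0, hd0⟩ = sec 0 - sec 1 ^ p := by
      apply germ_injective_of_isIntegral V v hvU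
      change algebraMap Γ(V, Ua) (V.presheaf.stalk v) (sec (⟨0, hd0⟩ : Fin d).succ.succ) =
        algebraMap Γ(V, Ua) (V.presheaf.stalk v) (sec 0 - sec 1 ^ p)
      rw [haA, map_sub, map_pow, hsA, hcA, ht0]
    have hx' : x = algebraMap Γ(V, Ua) V.functionField (sec 0) := by
      rw [hxs, ← hsA, ← IsScalarTower.algebraMap_apply]
    obtain ⟨h, hh, H⟩ := spreads_of_parameter k p hp (𝔭 := (hUa.primeIdealOf ⟨v, hvU⟩).asIdeal)
      (V.presheaf.stalk v) x hd0 (fun i : Fin d => sec i.succ.succ) (sec 0) (sec 1) ha' hd ha0' hx'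
    exact exists_opens_of_spreads p V hVreg x v Ua hUa hvU h hh H
  · -- case (iv): nodal at `v`
    obtain ⟨u, f₁, c, t₁, t₂, e, hu, hc, he, ht, hd, hxu, hf⟩ := hN
    obtain ⟨⟨Ua, hUa⟩, hvU, -, sec, hsec⟩ :=
      exists_affineOpen_sections_of_germs V v ![u, f₁, c, t₁, t₂] ⊤ trivial
    haveI : Nonempty Ua := ⟨⟨v, hvU⟩⟩
    obtain ⟨algk, hft, hchar⟩ := exists_algebra_finiteType_sections p k V f Ua hUa
    letI := algk
    haveI := hft
    haveI := hchar
    letI := TopCat.Presheaf.algebra_section_stalk V.presheaf (⟨v, hvU⟩ : Ua)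
    haveI := hUa.isLocalization_stalk ⟨v, hvU⟩
    haveI := hUa.primeIdealOf_isMaximal_of_isClosed ⟨v, hvU⟩ hv
    haveI := functionField_isScalarTower V Ua ⟨v, hvU⟩
    have hgerm : ∀ z : Γ(V, Ua),
        algebraMap Γ(V, Ua) (V.presheaf.stalk v) z = V.presheaf.germ Ua v hvU z := fun z => rfl
    have h0 : algebraMap Γ(V, Ua) (V.presheaf.stalk v) (sec 0) = u := by
      rw [hgerm, hsec]; rfl
    have h1 : algebraMap Γ(V, Ua) (V.presheaf.stalk v) (sec 1) = f₁ := by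
      rw [hgerm, hsec]; rfl
    have h2 : algebraMap Γ(V, Ua) (V.presheaf.stalk v) (sec 2) = c := by
      rw [hgerm, hsec]; rfl
    have h3 : algebraMap Γ(V, Ua) (V.presheaf.stalk v) (sec 3) = t₁ := by
      rw [hgerm, hsec]; rfl
    have h4 : algebraMap Γ(V, Ua) (V.presheaf.stalk v) (sec 4) = t₂ := by
      rw [hgerm, hsec]; rfl
    have hu𝔭 : sec 0 ∉ (hUa.primeIdealOf ⟨v, hvU⟩).asIdeal :=
      (IsLocalization.AtPrime.isUnit_to_map_iff (V.presheaf.stalk v)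
        (hUa.primeIdealOf ⟨v, hvU⟩).asIdeal (sec 0)).mp (h0 ▸ hu)
    have hc𝔭 : sec 2 ∉ (hUa.primeIdealOf ⟨v, hvU⟩).asIdeal :=
      (IsLocalization.AtPrime.isUnit_to_map_iff (V.presheaf.stalk v)
        (hUa.primeIdealOf ⟨v, hvU⟩).asIdeal (sec 2)).mp (h2 ▸ hc)
    have ha' : Ideal.span {algebraMap Γ(V, Ua) (V.presheaf.stalk v) (sec 3),
        algebraMap Γ(V, Ua) (V.presheaf.stalk v) (sec 4)} = maximalIdeal (V.presheaf.stalk v) := by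
      rw [h3, h4]
      exact ht
    have hx' : x = algebraMap Γ(V, Ua) V.functionField (sec 0 * sec 1 ^ e) := by
      rw [hxu, IsScalarTower.algebraMap_apply Γ(V, Ua) (V.presheaf.stalk v) V.functionField]
      congr 1
      rw [map_mul, map_pow, h0, h1]
    have hf' : algebraMap Γ(V, Ua) (V.presheaf.stalk v) (sec 1 - sec 2 * sec 3 * sec 4) ∈
        maximalIdeal (V.presheaf.stalk v) ^ 3 := by
      rw [map_sub, map_mul, map_mul, h1, h2, h3, h4]
      exact hf
    obtain ⟨h, hh, H⟩ := spreads_of_nodal k p hp (𝔭 := (hUa.primeIdealOf ⟨v, hvU⟩).asIdeal)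
      (V.presheaf.stalk v) x (sec 0) (sec 1) (sec 2) (sec 3) (sec 4) e hu𝔭 hc𝔭 he ha' hd hx' hf'
    exact exists_opens_of_spreads p V hVreg x v Ua hUa hvU h hh H


end Summit.ResolutionOfSingularities.ResolutionOfSingularities.Theorems.RadicialJung.CleanModels

end
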